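import Mathlib
import HarnessLib

/-!
# Route `LeeYangFibres`, crux `FibreHyperbolicityAlong` (stmt-Parity-18103), line
# `sifted-chowla-distillation`: margin from zero geometry — ELEMENTARY BOUNDS
# (helper file 1 of `stub_lobeMarginOfZeroGeometry`)

Pure real analysis (Mathlib only), namespace `MarginGeometry`.  The setting of the main file
(`…AlongMarginGeometry.lean`, `margin_from_geometry`): reals `0 < a_0 < a_1 < ⋯ < a_{d-1}` with
`a_0 ≤ B`, gaps `a_{i+1} - a_i ≥ 1` and NON-DECREASING.  Here:

* gap bookkeeping (`gap_mono`, `sub_le_mul_gap`, `mul_gap_le_sub`, `le_sub_of_gap`, `a_pos`, `a_lt`,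
  `a_le`) and the CHORD inequality `(K - i)(a_K - a_0) ≤ K (a_K - a_i)` of a sequence with
  non-decreasing increments (`convex_chord`);
* the per-factor bounds at the midpoint `m` of the gap `(a_p, a_{p+1})`:
  below, `i = p - n`: `(n + ½)(m + a_i) ≤ 2(B + p + 1)(m - a_i)` (`below_factor`);
  above, `i = p + 1 + n`: `(n + ½)(a_i + m) ≤ 2(B + p + 1 + n)(a_i - m)` (`above_factor`);
* the tolerance and constant bookkeeping of every lobe (`tol_le`, `lobe_finish`);
* the explicit products `e^{-M}/4^k ≤ ∏_{n<k} (n+½)/(2M)` (`prod_below_bound`, from `M^k/k! ≤ e^M`),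
  `1/(4^N 2^{M+N}) ≤ ∏_{n<N} (n+½)/(2(M+1+n))` (`prod_above_bound`, from `C(M+N,N) ≤ 2^{M+N}`), and the
  numeric glue `e^{-(2B+4d)} ≤ [e^{-(B+p+1)}/4^{p+1}] · [1/(4^N 2^{B+p+N})]`, `d = p + 1 + N`
  (`numeric_bound`, restated fully qualified as the registered helper stub `stub_marginGeometryAux`).

-- adapted from work/stubs/RobustRowExpGeometry.lean (wave 1), helper `def gap` inlined.
-/

noncomputable section

namespace Summit.Parity.GeneralizedHardyLittlewood.Cruxes.FibreHyperbolicityAlong.SiftedChowlaDistillation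

namespace MarginGeometry

open scoped BigOperators
open Finset

variable {d : ℕ} {a : ℕ → ℝ}

/-! ### Gaps -/

/-- Non-decreasing gaps, chained: `a_{l+1} - a_l ≤ a_{l+n+1} - a_{l+n}` inside the range. -/
theorem gap_mono (hmono : ∀ i : ℕ, i + 2 < d → a (i + 1) - a i ≤ a (i + 2) - a (i + 1)) :
    ∀ n l : ℕ, l + n + 1 < d → a (l + 1) - a l ≤ a (l + n + 1) - a (l + n)
  | 0, l, _ => by simp
  | n + 1, l, h => by
    have ih := gap_mono hmono n l (by omega)
    have hstep : a (l + n + 1) - a (l + n) ≤ a (l + n + 2) - a (l + n + 1) := hmono (l + n) (by omega)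
    rw [show l + (n + 1) + 1 = l + n + 2 by omega, show l + (n + 1) = l + n + 1 by omega]
    exact ih.trans hstep

/-- Upper bound by the largest gap involved: `a_{i+n} - a_i ≤ n (a_{l+1} - a_l)` if `i + n ≤ l + 1`. -/
theorem sub_le_mul_gap (hmono : ∀ i : ℕ, i + 2 < d → a (i + 1) - a i ≤ a (i + 2) - a (i + 1)) :
    ∀ n i l : ℕ, i + n ≤ l + 1 → l + 1 < d → a (i + n) - a i ≤ n * (a (l + 1) - a l)
  | 0, i, l, _, _ => by simp
  | n + 1, i, l, h1, h2 => by
    have ih := sub_le_mul_gap hmono n i l (by omega) h2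
    have hg : a (i + n + 1) - a (i + n) ≤ a (l + 1) - a l := by
      have := gap_mono hmono (l - (i + n)) (i + n) (by omega)
      rwa [show i + n + (l - (i + n)) = l by omega] at this
    have hid : a (i + (n + 1)) - a i = (a (i + n + 1) - a (i + n)) + (a (i + n) - a i) := by
      rw [show i + (n + 1) = i + n + 1 by omega]; ring
    rw [hid]
    push_cast
    linarith

/-- Lower bound by the smallest gap involved: `n (a_{l+1} - a_l) ≤ a_{i+n} - a_i` if `l ≤ i`. -/
theorem mul_gap_le_sub (hmono : ∀ i : ℕ, i + 2 < d → a (i + 1) - a i ≤ a (i + 2) - a (i + 1)) :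
    ∀ n l i : ℕ, l ≤ i → i + n < d → n * (a (l + 1) - a l) ≤ a (i + n) - a i
  | 0, l, i, _, _ => by simp
  | n + 1, l, i, h1, h2 => by
    have ih := mul_gap_le_sub hmono n l i h1 (by omega)
    have hg : a (l + 1) - a l ≤ a (i + n + 1) - a (i + n) := by
      have := gap_mono hmono (i + n - l) l (by omega)
      rwa [show l + (i + n - l) = i + n by omega] at this
    have hid : a (i + (n + 1)) - a i = (a (i + n + 1) - a (i + n)) + (a (i + n) - a i) := by
      rw [show i + (n + 1) = i + n + 1 by omega]; ring
    rw [hid]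
    push_cast
    linarith

/-- Lower bound by unit gaps: `n ≤ a_{i+n} - a_i`. -/
theorem le_sub_of_gap (hgap : ∀ i : ℕ, i + 1 < d → 1 ≤ a (i + 1) - a i) :
    ∀ n i : ℕ, i + n < d → (n : ℝ) ≤ a (i + n) - a i
  | 0, i, _ => by simp
  | n + 1, i, h => by
    have ih := le_sub_of_gap hgap n i (by omega)
    have h1 := hgap (i + n) (by omega)
    rw [show i + (n + 1) = i + n + 1 by omega]
    push_cast
    linarith

/-- All zeros are positive: `0 < a_i` (`a_i ≥ a_0 + i`). -/
theorem a_pos (hgap : ∀ i : ℕ, i + 1 < d → 1 ≤ a (i + 1) - a i) (ha0 : 0 < a 0) {i : ℕ} (hi : i < d) :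
    0 < a i := by
  have h := le_sub_of_gap hgap i 0 (by omega)
  rw [zero_add] at h
  have : (0 : ℝ) ≤ i := Nat.cast_nonneg i
  linarith

/-- The zeros increase strictly. -/
theorem a_lt (hgap : ∀ i : ℕ, i + 1 < d → 1 ≤ a (i + 1) - a i) {i j : ℕ} (hij : i < j) (hj : j < d) :
    a i < a j := by
  have h := le_sub_of_gap hgap (j - i) i (by omega)
  rw [show i + (j - i) = j by omega, Nat.cast_sub hij.le] at h
  have : (i : ℝ) + 1 ≤ j := by exact_mod_cast hij
  linarith

/-- The zeros increase. -/
theorem a_le (hgap : ∀ i : ℕ, i + 1 < d → 1 ≤ a (i + 1) - a i) {i j : ℕ} (hij : i ≤ j) (hj : j < d) :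
    a i ≤ a j := by
  rcases hij.eq_or_lt with rfl | h
  · exact le_rfl
  · exact (a_lt hgap h hj).le

/-- Chord inequality for a sequence with non-decreasing increments:
`(K - i)(a_K - a_0) ≤ K (a_K - a_i)` for `i ≤ K < d`. -/
theorem convex_chord (hmono : ∀ i : ℕ, i + 2 < d → a (i + 1) - a i ≤ a (i + 2) - a (i + 1))
    {K i : ℕ} (hK : K < d) (hi : i ≤ K) :
    ((K : ℝ) - i) * (a K - a 0) ≤ K * (a K - a i) := by
  rcases Nat.eq_zero_or_pos i with rfl | hi0
  · simp
  · have hi1 : i - 1 + 1 = i := by omega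
    have h1 : a i - a 0 ≤ i * (a i - a (i - 1)) := by
      have := sub_le_mul_gap hmono i 0 (i - 1) (by omega) (by omega)
      rwa [hi1, zero_add] at this
    have h2 : ((K - i : ℕ) : ℝ) * (a i - a (i - 1)) ≤ a K - a i := by
      have := mul_gap_le_sub hmono (K - i) (i - 1) i (by omega) (by omega)
      rwa [show i + (K - i) = K by omega, hi1] at this
    rw [Nat.cast_sub hi] at h2
    have hKi : (0 : ℝ) ≤ (K : ℝ) - i := by
      have : (i : ℝ) ≤ K := by exact_mod_cast hi
      linarith
    have hi0' : (0 : ℝ) ≤ i := Nat.cast_nonneg i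
    nlinarith [mul_le_mul_of_nonneg_left h1 hKi, mul_le_mul_of_nonneg_left h2 hi0']

/-! ### Per-factor bounds -/

/-- BELOW the lobe: for the midpoint `m` of the gap `(a_p, a_{p+1})` and `i = p - n`,
`(n + 1/2)(m + a_i) ≤ 2(B + p + 1)(m - a_i)`. -/
theorem below_factor (hgap : ∀ i : ℕ, i + 1 < d → 1 ≤ a (i + 1) - a i)
    (hmono : ∀ i : ℕ, i + 2 < d → a (i + 1) - a i ≤ a (i + 2) - a (i + 1))
    {B : ℝ} (hB : 0 ≤ B) (ha0 : a 0 ≤ B) {p n : ℕ} (hp : p + 1 < d) (hn : n ≤ p) :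
    ((n : ℝ) + 1 / 2) * ((a p + a (p + 1)) / 2 + a (p - n)) ≤
      2 * (B + p + 1) * ((a p + a (p + 1)) / 2 - a (p - n)) := by
  set g := a (p + 1) - a p with hg
  set t := a p - a (p - n) with ht
  set S := a p - a 0 with hS
  have f2 : 1 ≤ g := hgap p hp
  have f3 : (n : ℝ) ≤ t := by
    have := le_sub_of_gap hgap n (p - n) (by omega)
    rwa [show p - n + n = p by omega] at this
  have f4 : (n : ℝ) * S ≤ p * t := by
    have := convex_chord hmono (K := p) (i := p - n) (by omega) (by omega)
    rw [Nat.cast_sub hn] at this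
    have e : ((p : ℝ) - (p - n)) = n := by ring
    rw [e] at this
    exact this
  have f5 : a (p - n) - a 0 ≤ ((p - n : ℕ) : ℝ) * g := by
    have := sub_le_mul_gap hmono (p - n) 0 p (by omega) hp
    simpa using this
  rw [Nat.cast_sub hn] at f5
  have hn0 : (0 : ℝ) ≤ n := Nat.cast_nonneg n
  have ht0 : 0 ≤ t := le_trans hn0 f3
  -- key: (n + 1/2) m ≤ (B + p + 1/2)(m - a_i), then m + a_i ≤ 2m and B + p + 1/2 ≤ B + p + 1
  have hm : (a p + a (p + 1)) / 2 = a 0 + S + g / 2 := by rw [hS, hg]; ring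
  have hmi : (a p + a (p + 1)) / 2 - a (p - n) = t + g / 2 := by rw [ht, hg]; ring
  have key : ((n : ℝ) + 1 / 2) * (a 0 + S + g / 2) ≤ (B + p + 1 / 2) * (t + g / 2) := by
    have e : (B + p + 1 / 2) * (t + g / 2) - ((n : ℝ) + 1 / 2) * (a 0 + S + g / 2) =
        ((n : ℝ) + 1 / 2) * (B - a 0) + B * ((g - 1) / 2 + (t - n)) + (p * t - n * S) +
          (1 / 2) * (((p : ℝ) - n) * g - (S - t)) := by ring
    have hSt : S - t = a (p - n) - a 0 := by rw [hS, ht]; ring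
    nlinarith [mul_nonneg (by linarith : (0 : ℝ) ≤ (n : ℝ) + 1 / 2) (by linarith : (0 : ℝ) ≤ B - a 0),
      mul_nonneg hB (by linarith : (0 : ℝ) ≤ (g - 1) / 2 + (t - n))]
  have hai : a (p - n) ≤ a 0 + S + g / 2 := by
    have : a (p - n) ≤ a p := by linarith
    rw [hS]; linarith
  rw [hm] at hmi ⊢
  rw [hmi]
  have hp0 : (0 : ℝ) ≤ p := Nat.cast_nonneg p
  have htg : 0 ≤ t + g / 2 := by linarith
  nlinarith [key, mul_le_mul_of_nonneg_left hai (by linarith : (0 : ℝ) ≤ (n : ℝ) + 1 / 2)]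

/-- ABOVE the lobe: for the midpoint `m` of the gap `(a_p, a_{p+1})` and `i = p + 1 + n`,
`(n + 1/2)(a_i + m) ≤ 2(B + p + 1 + n)(a_i - m)`. -/
theorem above_factor (hgap : ∀ i : ℕ, i + 1 < d → 1 ≤ a (i + 1) - a i)
    (hmono : ∀ i : ℕ, i + 2 < d → a (i + 1) - a i ≤ a (i + 2) - a (i + 1))
    {B : ℝ} (hB : 0 ≤ B) (ha0 : a 0 ≤ B) {p n : ℕ} (hn : p + 1 + n < d) :
    ((n : ℝ) + 1 / 2) * (a (p + 1 + n) + (a p + a (p + 1)) / 2) ≤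
      2 * (B + p + 1 + n) * (a (p + 1 + n) - (a p + a (p + 1)) / 2) := by
  set g := a (p + 1) - a p with hg
  have f2 : 1 ≤ g := hgap p (by omega)
  have hw : ((n : ℝ) + 1 / 2) * g ≤ a (p + 1 + n) - (a p + a (p + 1)) / 2 := by
    have := mul_gap_le_sub hmono n p (p + 1) (by omega) hn
    rw [← hg] at this
    nlinarith
  have hm : (a p + a (p + 1)) / 2 ≤ B + p * g + g / 2 := by
    have := sub_le_mul_gap hmono p 0 p (by omega) (by omega)
    rw [← hg, zero_add] at this
    linarith
  set w := a (p + 1 + n) - (a p + a (p + 1)) / 2 with hwdef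
  set m := (a p + a (p + 1)) / 2 with hmdef
  have hn0 : (0 : ℝ) ≤ n := Nat.cast_nonneg n
  have hp0 : (0 : ℝ) ≤ p := Nat.cast_nonneg p
  have hcoef : (0 : ℝ) ≤ 2 * B + 2 * p + n + 3 / 2 := by linarith
  have e1 : a (p + 1 + n) + m = w + 2 * m := by rw [hwdef]; ring
  rw [e1]
  have h1 := mul_le_mul_of_nonneg_right hw hcoef
  have h2 := mul_le_mul_of_nonneg_left hm (by linarith : (0 : ℝ) ≤ 2 * n + 1)
  nlinarith [mul_nonneg (by linarith : (0 : ℝ) ≤ (n : ℝ) + 1 / 2) (mul_nonneg hB (by linarith : (0 : ℝ) ≤ g - 1)),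
    mul_nonneg (by linarith : (0 : ℝ) ≤ (n : ℝ) + 1 / 2) (mul_nonneg (by linarith : (0 : ℝ) ≤ g) hn0)]

/-! ### Lobe bookkeeping -/

/-- Tolerance absorbs into `(1 + m) D`: `∏ (m + a_i) + m^(d+1) ≤ (1 + m) ∏ (m + a_i)`. -/
theorem tol_le {m : ℝ} (hm : 0 ≤ m) (ha : ∀ i : ℕ, i < d → 0 < a i) :
    (∏ i ∈ range d, (m + a i)) + m ^ (d + 1) ≤ (1 + m) * ∏ i ∈ range d, (m + a i) := by
  have hpow : m ^ d ≤ ∏ i ∈ range d, (m + a i) := by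
    have e : m ^ d = ∏ _i ∈ range d, m := by rw [Finset.prod_const, Finset.card_range]
    rw [e]
    exact Finset.prod_le_prod (fun i _ => hm) fun i hi => by
      have := ha i (Finset.mem_range.mp hi); linarith
  have : m ^ (d + 1) ≤ m * ∏ i ∈ range d, (m + a i) := by
    rw [pow_succ, mul_comm]
    exact mul_le_mul_of_nonneg_left hpow hm
  linarith

/-- The common last step of every lobe: absorb the top tolerance term and the constants
(`1 + m ≤ 1 + 2e^{Bd} < e^{Bd+2}` and `e^{-(6+3B)d} e^{Bd+2} ≤ e^{-(2B+4d)}`). -/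
theorem lobe_finish {B d : ℕ} (hd : 1 ≤ d) {D Num m T : ℝ} (hD : 0 < D)
    (hm : m ≤ 2 * Real.exp ((B : ℝ) * d)) (hT : T ≤ (1 + m) * D)
    (hNum : Real.exp (-(2 * (B : ℝ) + 4 * (d : ℝ))) * D ≤ Num) :
    Real.exp (-((6 + 3 * (B : ℝ)) * d)) * T < Num := by
  have he1 : (2 : ℝ) ≤ Real.exp 1 := by
    have := Real.add_one_le_exp (1 : ℝ)
    norm_num at this ⊢
    linarith
  have h3 : (3 : ℝ) < Real.exp 2 := by
    have h2 : Real.exp 2 = Real.exp 1 * Real.exp 1 := by rw [← Real.exp_add]; norm_num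
    rw [h2]
    nlinarith
  have hE1 : (1 : ℝ) ≤ Real.exp ((B : ℝ) * d) := Real.one_le_exp (by positivity)
  have h1m : 1 + m < Real.exp 2 * Real.exp ((B : ℝ) * d) := by nlinarith
  have hK : Real.exp (-((6 + 3 * (B : ℝ)) * d)) * (Real.exp 2 * Real.exp ((B : ℝ) * d)) ≤
      Real.exp (-(2 * (B : ℝ) + 4 * (d : ℝ))) := by
    rw [← Real.exp_add, ← Real.exp_add, Real.exp_le_exp]
    have hd' : (1 : ℝ) ≤ d := by exact_mod_cast hd
    have hB0 : (0 : ℝ) ≤ B := Nat.cast_nonneg B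
    nlinarith [mul_nonneg hB0 (by linarith : (0 : ℝ) ≤ (d : ℝ) - 1)]
  have he0 : 0 < Real.exp (-((6 + 3 * (B : ℝ)) * d)) := Real.exp_pos _
  calc Real.exp (-((6 + 3 * (B : ℝ)) * d)) * T
      ≤ Real.exp (-((6 + 3 * (B : ℝ)) * d)) * ((1 + m) * D) := by gcongr
    _ < Real.exp (-((6 + 3 * (B : ℝ)) * d)) * ((Real.exp 2 * Real.exp ((B : ℝ) * d)) * D) := by gcongr
    _ = (Real.exp (-((6 + 3 * (B : ℝ)) * d)) * (Real.exp 2 * Real.exp ((B : ℝ) * d))) * D := by ring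
    _ ≤ Real.exp (-(2 * (B : ℝ) + 4 * (d : ℝ))) * D := by gcongr
    _ ≤ Num := hNum

/-! ### Explicit product bounds -/

/-- `exp (-M) ≤ k! / M^k` (from `M^k / k! ≤ exp M`), with `k! = ∏_{n<k} (n+1)`. -/
theorem exp_neg_le_prod_div_pow {M : ℝ} (hM : 0 < M) (k : ℕ) :
    Real.exp (-M) ≤ (∏ n ∈ range k, ((n : ℝ) + 1)) / M ^ k := by
  have h := Real.pow_div_factorial_le_exp M hM.le k
  have hfac : (∏ n ∈ range k, ((n : ℝ) + 1)) = ((Nat.factorial k : ℕ) : ℝ) := by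
    rw [← Finset.prod_range_add_one_eq_factorial, Nat.cast_prod]
    push_cast
    rfl
  have hk : (0 : ℝ) < ((Nat.factorial k : ℕ) : ℝ) := by exact_mod_cast Nat.factorial_pos k
  rw [hfac, Real.exp_neg, le_div_iff₀ (pow_pos hM k)]
  rw [div_le_iff₀ hk] at h
  calc (Real.exp M)⁻¹ * M ^ k ≤ (Real.exp M)⁻¹ * (Real.exp M * ((Nat.factorial k : ℕ) : ℝ)) :=
        mul_le_mul_of_nonneg_left h (inv_nonneg.mpr (Real.exp_pos M).le)
    _ = ((Nat.factorial k : ℕ) : ℝ) := by field_simp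

/-- BELOW product: `exp (-M) / 4^k ≤ ∏_{n<k} (n + 1/2)/(2M)`. -/
theorem prod_below_bound {M : ℝ} (hM : 0 < M) (k : ℕ) :
    Real.exp (-M) / 4 ^ k ≤ ∏ n ∈ range k, (((n : ℝ) + 1 / 2) / (2 * M)) := by
  have hterm : ∀ n ∈ range k, ((n : ℝ) + 1) / (4 * M) ≤ ((n : ℝ) + 1 / 2) / (2 * M) := by
    intro n _
    rw [div_le_div_iff₀ (by positivity) (by positivity)]
    have hn : (0 : ℝ) ≤ n := Nat.cast_nonneg n
    nlinarith
  calc Real.exp (-M) / 4 ^ k ≤ (∏ n ∈ range k, ((n : ℝ) + 1)) / M ^ k / 4 ^ k := by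
        gcongr
        exact exp_neg_le_prod_div_pow hM k
    _ = ∏ n ∈ range k, (((n : ℝ) + 1) / (4 * M)) := by
        rw [Finset.prod_div_distrib, Finset.prod_const, Finset.card_range, mul_pow, mul_comm ((4 : ℝ) ^ k),
          div_div]
    _ ≤ ∏ n ∈ range k, (((n : ℝ) + 1 / 2) / (2 * M)) :=
        Finset.prod_le_prod (fun n _ => by positivity) hterm

/-- The binomial identity behind the ABOVE product: `C(M+N, N) · ∏_{n<N} (n+1)/(M+1+n) = 1`. -/
theorem choose_mul_prod_eq_one (M N : ℕ) :
    ((M + N).choose N : ℝ) * ∏ n ∈ range N, (((n : ℝ) + 1) / ((M : ℝ) + 1 + n)) = 1 := by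
  have h1 : (M + N).choose N * Nat.factorial M * Nat.factorial N = Nat.factorial (M + N) :=
    Nat.add_choose_mul_factorial_mul_factorial M N
  have h2 : Nat.factorial M * ∏ n ∈ range N, (M + 1 + n) = Nat.factorial (M + N) := by
    rw [← Nat.ascFactorial_eq_prod_range]
    exact Nat.factorial_mul_ascFactorial M N
  have h3 : (M + N).choose N * ∏ n ∈ range N, (n + 1) = ∏ n ∈ range N, (M + 1 + n) := by
    rw [Finset.prod_range_add_one_eq_factorial]
    apply Nat.eq_of_mul_eq_mul_left (Nat.factorial_pos M)
    calc Nat.factorial M * ((M + N).choose N * Nat.factorial N)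
        = (M + N).choose N * Nat.factorial M * Nat.factorial N := by ring
      _ = Nat.factorial (M + N) := h1
      _ = Nat.factorial M * ∏ n ∈ range N, (M + 1 + n) := h2.symm
  have h3' : (((M + N).choose N : ℕ) : ℝ) * ∏ n ∈ range N, ((n : ℝ) + 1) =
      ∏ n ∈ range N, ((M : ℝ) + 1 + n) := by
    have := congrArg (Nat.cast (R := ℝ)) h3
    push_cast at this
    exact this
  have hpos : (0 : ℝ) < ∏ n ∈ range N, ((M : ℝ) + 1 + n) := Finset.prod_pos fun n _ => by positivity
  rw [Finset.prod_div_distrib, ← mul_div_assoc, h3', div_self hpos.ne']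

/-- ABOVE product: `1/(4^N · 2^(M+N)) ≤ ∏_{n<N} (n + 1/2)/(2(M+1+n))`. -/
theorem prod_above_bound (M N : ℕ) :
    1 / ((4 : ℝ) ^ N * 2 ^ (M + N)) ≤ ∏ n ∈ range N, (((n : ℝ) + 1 / 2) / (2 * ((M : ℝ) + 1 + n))) := by
  have hterm : ∀ n ∈ range N,
      (1 / 4) * (((n : ℝ) + 1) / ((M : ℝ) + 1 + n)) ≤ ((n : ℝ) + 1 / 2) / (2 * ((M : ℝ) + 1 + n)) := by
    intro n _
    have hn : (0 : ℝ) ≤ n := Nat.cast_nonneg n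
    have hL : (0 : ℝ) < (M : ℝ) + 1 + n := by positivity
    rw [← mul_div_assoc, div_le_div_iff₀ hL (by positivity)]
    nlinarith
  have hchoose : ((M + N).choose N : ℝ) ≤ 2 ^ (M + N) := by
    exact_mod_cast Nat.choose_le_two_pow (M + N) N
  have hcpos : (0 : ℝ) < ((M + N).choose N : ℝ) := by
    exact_mod_cast Nat.choose_pos (Nat.le_add_left N M)
  have hprod : ∏ n ∈ range N, (((n : ℝ) + 1) / ((M : ℝ) + 1 + n)) = 1 / ((M + N).choose N : ℝ) := by
    rw [eq_div_iff hcpos.ne', mul_comm]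
    exact choose_mul_prod_eq_one M N
  calc 1 / ((4 : ℝ) ^ N * 2 ^ (M + N)) ≤ 1 / ((4 : ℝ) ^ N * ((M + N).choose N : ℝ)) := by
        gcongr
    _ = ∏ n ∈ range N, ((1 / 4) * (((n : ℝ) + 1) / ((M : ℝ) + 1 + n))) := by
        rw [Finset.prod_mul_distrib, Finset.prod_const, Finset.card_range, hprod]
        rw [one_div_pow]
        ring
    _ ≤ ∏ n ∈ range N, (((n : ℝ) + 1 / 2) / (2 * ((M : ℝ) + 1 + n))) :=
        Finset.prod_le_prod (fun n _ => by positivity) hterm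

/-- `exp (-(j + 2k)) ≤ 1 / (2^j · 4^k)` (from `2 ≤ e`). -/
theorem exp_neg_le_one_div_pow (j k : ℕ) : Real.exp (-((j : ℝ) + 2 * k)) ≤ 1 / (2 ^ j * 4 ^ k) := by
  have h2 : (2 : ℝ) ≤ Real.exp 1 := by linarith [Real.add_one_le_exp (1 : ℝ)]
  have e : (2 : ℝ) ^ j * 4 ^ k = 2 ^ (j + 2 * k) := by
    rw [pow_add, pow_mul]
    norm_num
  rw [e, show -((j : ℝ) + 2 * k) = ((j + 2 * k : ℕ) : ℝ) * (-1) by push_cast; ring, Real.exp_nat_mul,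
    one_div, ← inv_pow, Real.exp_neg]
  apply pow_le_pow_left₀ (inv_nonneg.mpr (Real.exp_pos 1).le)
  exact inv_anti₀ (by norm_num) h2

/-- `exp (-2n) ≤ 1 / 4^n`. -/
theorem exp_neg_two_mul_le_one_div_four_pow (n : ℕ) : Real.exp (-(2 * (n : ℝ))) ≤ 1 / 4 ^ n := by
  simpa using exp_neg_le_one_div_pow 0 n

/-- The numeric bookkeeping: `exp (-(2B + 4d)) ≤ [exp (-(B+p+1)) / 4^(p+1)] · [1/(4^N · 2^(B+p+N))]`
with `d = p + 1 + N`. -/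
theorem numeric_bound (B p N : ℕ) :
    Real.exp (-(2 * (B : ℝ) + 4 * ((p + 1 + N : ℕ) : ℝ))) ≤
      Real.exp (-(((B + p : ℕ) : ℝ) + 1)) / 4 ^ (p + 1) * (1 / ((4 : ℝ) ^ N * 2 ^ (B + p + N))) := by
  have h := exp_neg_le_one_div_pow (B + p + N) (p + 1 + N)
  have e : Real.exp (-(((B + p : ℕ) : ℝ) + 1)) / 4 ^ (p + 1) * (1 / ((4 : ℝ) ^ N * 2 ^ (B + p + N))) =
      Real.exp (-(((B + p : ℕ) : ℝ) + 1)) * (1 / (2 ^ (B + p + N) * 4 ^ (p + 1 + N))) := by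
    rw [pow_add (4 : ℝ) (p + 1) N]
    ring
  rw [e]
  calc Real.exp (-(2 * (B : ℝ) + 4 * ((p + 1 + N : ℕ) : ℝ)))
      ≤ Real.exp (-(((B + p : ℕ) : ℝ) + 1)) *
          Real.exp (-(((B + p + N : ℕ) : ℝ) + 2 * ((p + 1 + N : ℕ) : ℝ))) := by
        rw [← Real.exp_add, Real.exp_le_exp]
        push_cast
        linarith
    _ ≤ Real.exp (-(((B + p : ℕ) : ℝ) + 1)) * (1 / (2 ^ (B + p + N) * 4 ^ (p + 1 + N))) := by
        gcongr

end MarginGeometry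

/-! ## Registered-stub form (for `--supports stmt-Parity-18103`) -/

/-- **Stub form of `MarginGeometry.numeric_bound`** (helper stub `stub_marginGeometryAux` of the line
`sifted-chowla-distillation`, Aux of `stub_lobeMarginOfZeroGeometry`; the header below is the registered one-line
signature verbatim, fully qualified): the numeric glue of the interior-lobe estimate,
`e^{-(2B+4(p+1+N))} ≤ [e^{-(B+p+1)}/4^{p+1}] · [1/(4^N 2^{B+p+N})]`. -/
theorem stub_marginGeometryAux : ∀ B p N : ℕ, Real.exp (-(2 * (B : ℝ) + 4 * ((p + 1 + N : ℕ) : ℝ))) ≤ Real.exp (-(((B + p : ℕ) : ℝ) + 1)) / 4 ^ (p + 1) * (1 / ((4 : ℝ) ^ N * 2 ^ (B + p + N))) :=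
  MarginGeometry.numeric_bound

end Summit.Parity.GeneralizedHardyLittlewood.Cruxes.FibreHyperbolicityAlong.SiftedChowlaDistillation

end
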